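import Summits.Ventures.HSemireg.ContractionSpanTwist
import Literature.AlgebraicGeometry.Motives.HodgeStructureExteriorPowerLefschetz
import HarnessLib

/-!
# Venture HSemireg — the polyvector contraction span of a two-term THETA class `a·1 + b·e^{c}`
# (`c` a `(1,1)` twist class): `span = W + e^{c}·W` for the `Λ²`-block `W` of `L`, and
# `finrank = dim W + rank(c ∧ · on W)` (th-7's theta-divisor 2-secant factor, all dimensions)

HONEST FRAMING. Pure linear algebra in the exterior algebra `Λ V`, written for the computation cell
`pub-hsemireg` (seat p6, «`⊗ M` / Mukai-transform facts used by the amplification chain») over seat p4's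
abstract contraction span `ContractionSpan.span L Θ x` (`ContractionSpanAlgebra.lean`) and this seat's twist
engine (`ContractionSpanTwist.lean`). Nothing here is a claim about any variety; nothing here says that
HC / HC_CM / HC_AV holds. Everything is PROVED; no named fact, no new definition.

THE STEP SERVED. th-7's family table (`theory/FORMULA-N-th7.md` §E row TH, §B.3–B.4, Def. A.2) lists, next to the
point-ideal factor `ch(I_p) = 1 - [pt]` (kernel: p4's T_lin, `ContractionSpanPointIdeal.lean`), the THETA-DIVISOR
2-secant factors of a principally polarised abelian `n`-fold (e.g. `ch(i_*𝒪_Θ(mΘ)) = e^{mθ} - e^{(m-1)θ}`; th-7's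
2-secant classes `A·e^{λθ} + B·e^{μθ}`, `λ ≠ μ`), i.e. (after the twist `e^{μθ}`, rank-neutral by `rank_span_mul_expSum_eq`)
classes `a·1 + b·e^{c}` with `c = (λ - μ)θ` a NON-DEGENERATE `(1,1)` class (`ch` itself is BY VALUE throughout). The claimed factor profile is
`(r₀, r₁, r₂) = (1, 2n, 2·C(n,2))` for `n ≥ 3` and `(1, 4, 1)` for `n = 2` — so far a seat derivation plus engine
checks. This file proves the STRUCTURE THEOREM behind `r₂` for every `n`, in the tree's contraction currency:
* §1 `contractLeft_contractLeft_eq_zero_of_mem_twist`: two vector fields kill a `(1,1) ⊕ (0,2)` twist class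
  (`ι_ψ ι_φ c = 0`); wedge-block membership of `q ∧ β`, `β₁ ∧ β₂` for `β, βᵢ ∈ span L`.
* §2 (any central `E` with the conjugation rule `ι_φ(E ∧ z) = E ∧ (ι_φ z + (ι_φ c) ∧ z)` of `ContractionSpanTwist`):
  the three generator families of `span L Θ (a·1 + b·E)` are `a·q₁∧q₂ + b·E∧q₁∧q₂`, `b·E∧q∧ι_φ c`,
  `b·E∧(ι_ψ c)∧(ι_φ c)` (`gen_wedge_secant`, `gen_mixed_secant`, `gen_contract_secant`); hence
  `span ≤ W ⊔ E·W` (`span_secant_le`), and `= W ⊔ E·W` (`span_secant_eq`) as soon as `a, b` are units and `c` is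
  NON-DEGENERATE: `ι_φ c`, `φ ∈ Θ`, spans `L` (for a principal polarisation `c = Σᵢ pᵢ ∧ qᵢ`, `ι_{pⱼ*} c = qⱼ`).
* §3–§4 (field of characteristic `0`, `E = e^{c} = Σ_{k<N} cᵏ/k!`, `c^N = 0`): `W ⊔ e^{c}W = W ⊔ (e^{c} - 1)W`,
  `e^{c} - 1 = c ∧ E'` with `E'` a central UNIT, `(e^{c} - 1)W` sits in degrees `≠ deg W` — so for ANY block `W ⊆ Λᵈ V`
  `finrank (W ⊔ e^{c}W) = finrank W + finrank (c ∧ W)` (`finrank_sup_map_expSum_eq`), and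
  `finrank span L Θ (a·1 + b·e^{c}) = dim W + rank(c ∧ · on W)` (`finrank_span_secant_eq_add`): the two K-isotypic
  pieces of th-7's A.3 for this factor are `W = Λ²L` and its Lefschetz image `c ∧ Λ²L`.
The sequel `ContractionSpanThetaSecantDarboux.lean` instantiates `c = Σᵢ pᵢ ∧ qᵢ` on a Darboux basis (the tree's
`ExteriorLefschetz.twoVector`, hard Lefschetz `IsSymplectic.eq_zero_of_pow_mul_eq_zero`): `2·C(n,2)` for `n ≥ 3`,
`1` for `n = 2`, `r₁ = 2n`, and the real-carrier `contractionRank` form.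
References: [BourbakiAlgebre1a3] Ch. III §7, §11 no. 9 (even elements central; interior products are
antiderivations); [BuchweitzFlenner2008HH] Prop. 6.4.4 (`σ_F ∘ c_F = ⌟ ch F`: why these operators);
[Lange2023AbelianVarietiesComplex] §7.3.2 (the Lefschetz operator `u ↦ E ∧ u` of a polarisation).
-/

noncomputable section

open CliffordAlgebra (contractLeft)
open ExteriorAlgebra (ι)
open Module
open Literature.AlgebraicGeometry.Motives Literature.AlgebraicGeometry.HodgeTheory

namespace Summit.Ventures.HSemireg

namespace ContractionSpan

section Ring
variable {K : Type*} [CommRing K] {V : Type*} [AddCommGroup V] [Module K V]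

/-! ### 1. Vector fields kill `span L`; wedge-block membership -/

/-- `ι_ψ β = 0` for `β ∈ span L` and `ψ` killing `L`. [cite: BourbakiAlgebre1a3, Ch. III §11 no. 9] -/
theorem contractLeft_eq_zero_of_mem_span_image {L : Set V} {ψ : Module.Dual K V} (hψ : ∀ q ∈ L, ψ q = 0)
    {β : ExteriorAlgebra K V} (hβ : β ∈ Submodule.span K (ι K '' L)) : contractLeft ψ β = 0 := by
  induction hβ using Submodule.span_induction with
  | mem x hx => obtain ⟨q, hq, rfl⟩ := hx; rw [CliffordAlgebra.contractLeft_ι, hψ q hq, map_zero]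
  | zero => rw [map_zero]
  | add x y _ _ hx hy => rw [map_add, hx, hy, add_zero]
  | smul r x _ hx => rw [map_smul, hx, smul_zero]

/-- **Two vector fields kill a twist class**: `ι_ψ ι_φ c = 0` for `c ∈ span{v ∧ q : q ∈ L}` (type
`(1,1) ⊕ (0,2)`) and `φ, ψ` killing `L` — `ι_φ c ∈ span L` (`contractLeft_mem_span_image_of_mem_twist`) and
`ι_ψ` kills `span L`. («`H⁰(Λ² T)` pairs trivially with a `(1,1)`-class.») [cite: BourbakiAlgebre1a3, Ch. III §11 no. 9] -/
theorem contractLeft_contractLeft_eq_zero_of_mem_twist {L : Set V} {φ ψ : Module.Dual K V}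
    (hφ : ∀ q ∈ L, φ q = 0) (hψ : ∀ q ∈ L, ψ q = 0) {c : ExteriorAlgebra K V}
    (hc : c ∈ Submodule.span K {z : ExteriorAlgebra K V | ∃ v : V, ∃ q ∈ L, z = ι K v * ι K q}) :
    contractLeft ψ (contractLeft φ c) = 0 :=
  contractLeft_eq_zero_of_mem_span_image hψ (contractLeft_mem_span_image_of_mem_twist hφ hc)

/-- `q ∧ β ∈ W` (the `Λ²`-block of `L`) for `q ∈ L`, `β ∈ span L`. [cite: BourbakiAlgebre1a3, Ch. III §7] -/
theorem ι_mul_mem_wedgeBlock {L : Set V} {q : V} (hq : q ∈ L) {β : ExteriorAlgebra K V}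
    (hβ : β ∈ Submodule.span K (ι K '' L)) : ι K q * β ∈ wedgeBlock (K := K) L := by
  induction hβ using Submodule.span_induction with
  | mem x hx => obtain ⟨q₂, hq₂, rfl⟩ := hx; exact Submodule.subset_span ⟨q, hq, q₂, hq₂, rfl⟩
  | zero => rw [mul_zero]; exact Submodule.zero_mem _
  | add x y _ _ hx hy => rw [mul_add]; exact Submodule.add_mem _ hx hy
  | smul r x _ hx => rw [mul_smul_comm]; exact Submodule.smul_mem _ r hx

/-- `β₁ ∧ β₂ ∈ W` for `β₁, β₂ ∈ span L`. [cite: BourbakiAlgebre1a3, Ch. III §7] -/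
theorem mul_mem_wedgeBlock {L : Set V} {β₁ β₂ : ExteriorAlgebra K V} (hβ₁ : β₁ ∈ Submodule.span K (ι K '' L))
    (hβ₂ : β₂ ∈ Submodule.span K (ι K '' L)) : β₁ * β₂ ∈ wedgeBlock (K := K) L := by
  induction hβ₁ using Submodule.span_induction with
  | mem x hx => obtain ⟨q, hq, rfl⟩ := hx; exact ι_mul_mem_wedgeBlock hq hβ₂
  | zero => rw [zero_mul]; exact Submodule.zero_mem _
  | add x y _ _ hx hy => rw [add_mul]; exact Submodule.add_mem _ hx hy
  | smul r x _ hx => rw [smul_mul_assoc]; exact Submodule.smul_mem _ r hx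

/-- The twist classes lie in `Λ² V`. [cite: BourbakiAlgebre1a3, Ch. III §7] -/
theorem mem_exteriorPower_two_of_mem_span_ι_mul_ι {c : ExteriorAlgebra K V}
    (hc : c ∈ Submodule.span K {z : ExteriorAlgebra K V | ∃ v w : V, z = ι K v * ι K w}) : c ∈ ⋀[K]^2 V :=
  (Submodule.span_le.mpr (by rintro z ⟨v, w, rfl⟩; exact ι_mul_ι_mem_two v w)) hc

/-! ### 2. The secant class `a·1 + b·E` for a central `E` with the conjugation rule of `e^{c}` -/

section Secant

variable {L : Set V} {Θ : Set (Module.Dual K V)} {c E : ExteriorAlgebra K V}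

/-- From the conjugation rule `ι_φ(E ∧ z) = E ∧ (ι_φ z + (ι_φ c) ∧ z)` at `z = 1`: `ι_φ E = E ∧ ι_φ c`.
[cite: BourbakiAlgebre1a3, Ch. III §11 no. 9] -/
theorem contractLeft_eq_mul_of_rule {φ : Module.Dual K V}
    (hED : ∀ z : ExteriorAlgebra K V, contractLeft φ (E * z) = E * (contractLeft φ z + contractLeft φ c * z)) :
    contractLeft φ E = E * contractLeft φ c := by
  have h1 : contractLeft φ (1 : ExteriorAlgebra K V) = 0 := by
    rw [← (algebraMap K (ExteriorAlgebra K V)).map_one, CliffordAlgebra.contractLeft_algebraMap]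
  have h := hED 1
  rwa [mul_one, mul_one, h1, zero_add] at h

/-- `q₁ ∧ q₂ ∧ (a·1 + b·E) = a·(q₁ ∧ q₂) + b·E ∧ (q₁ ∧ q₂)` for central `E`. [cite: BourbakiAlgebre1a3, Ch. III §7] -/
theorem gen_wedge_secant (hEc : ∀ z, Commute E z) (a b : K) (q₁ q₂ : V) :
    ι K q₁ * (ι K q₂ * (algebraMap K _ a + b • E)) = a • (ι K q₁ * ι K q₂) + b • (E * (ι K q₁ * ι K q₂)) := by
  rw [mul_add, mul_add, ← Algebra.commutes, ← Algebra.smul_def, mul_smul_comm, mul_smul_comm, mul_smul_comm,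
    ← mul_assoc (ι K q₁) (ι K q₂) E, (hEc (ι K q₁ * ι K q₂)).eq]

/-- `q ∧ ι_φ (a·1 + b·E) = b·E ∧ q ∧ ι_φ c`. [cite: BourbakiAlgebre1a3, Ch. III §11 no. 9] -/
theorem gen_mixed_secant (hEc : ∀ z, Commute E z) {φ : Module.Dual K V}
    (hED : ∀ z : ExteriorAlgebra K V, contractLeft φ (E * z) = E * (contractLeft φ z + contractLeft φ c * z))
    (a b : K) (q : V) :
    ι K q * contractLeft φ (algebraMap K _ a + b • E) = b • (E * (ι K q * contractLeft φ c)) := by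
  rw [map_add, CliffordAlgebra.contractLeft_algebraMap, zero_add, map_smul, contractLeft_eq_mul_of_rule hED,
    mul_smul_comm, ← mul_assoc, ← (hEc (ι K q)).eq, mul_assoc]

/-- `ι_ψ ι_φ (a·1 + b·E) = b·E ∧ (ι_ψ c) ∧ (ι_φ c)` when `ι_ψ ι_φ c = 0`. [cite: BourbakiAlgebre1a3, Ch. III §11 no. 9] -/
theorem gen_contract_secant {φ ψ : Module.Dual K V}
    (hEDφ : ∀ z : ExteriorAlgebra K V, contractLeft φ (E * z) = E * (contractLeft φ z + contractLeft φ c * z))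
    (hEDψ : ∀ z : ExteriorAlgebra K V, contractLeft ψ (E * z) = E * (contractLeft ψ z + contractLeft ψ c * z))
    (hψφ : contractLeft ψ (contractLeft φ c) = 0) (a b : K) :
    contractLeft ψ (contractLeft φ (algebraMap K _ a + b • E)) = b • (E * (contractLeft ψ c * contractLeft φ c)) := by
  rw [map_add, CliffordAlgebra.contractLeft_algebraMap, zero_add, map_smul, map_smul, contractLeft_eq_mul_of_rule hEDφ,
    hEDψ, hψφ, zero_add]

/-- **`span L Θ (a·1 + b·E) ≤ W ⊔ E·W`** (`W` the `Λ²`-block of `L`) for `Θ` killing `L`, `c ∈ span{v ∧ q : q ∈ L}`,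
`E` central with the conjugation rule on `Θ`: by §1 all three generator families land in `W + E·W`.
[cite: BourbakiAlgebre1a3, Ch. III §11 no. 9] [cite: BuchweitzFlenner2008HH, Prop. 6.4.4] -/
theorem span_secant_le (hΘL : ∀ θ ∈ Θ, ∀ q ∈ L, θ q = 0)
    (hc : c ∈ Submodule.span K {z : ExteriorAlgebra K V | ∃ v : V, ∃ q ∈ L, z = ι K v * ι K q})
    (hEc : ∀ z, Commute E z)
    (hED : ∀ φ ∈ Θ, ∀ z : ExteriorAlgebra K V, contractLeft φ (E * z) = E * (contractLeft φ z + contractLeft φ c * z))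
    (a b : K) :
    span L Θ (algebraMap K _ a + b • E) ≤ wedgeBlock L ⊔ (wedgeBlock L).map (LinearMap.mulLeft K E) := by
  refine Submodule.span_le.mpr ?_
  rintro y ((⟨q₁, hq₁, q₂, hq₂, rfl⟩ | ⟨q, hq, φ, hφ, rfl⟩) | ⟨ψ, hψ, φ, hφ, rfl⟩)
  · rw [gen_wedge_secant hEc]
    exact Submodule.add_mem _
      (Submodule.mem_sup_left (Submodule.smul_mem _ _ (Submodule.subset_span ⟨q₁, hq₁, q₂, hq₂, rfl⟩)))
      (Submodule.mem_sup_right (Submodule.smul_mem _ _ ⟨_, Submodule.subset_span ⟨q₁, hq₁, q₂, hq₂, rfl⟩, rfl⟩))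
  · rw [gen_mixed_secant hEc (hED φ hφ)]
    exact Submodule.mem_sup_right (Submodule.smul_mem _ _
      ⟨_, ι_mul_mem_wedgeBlock hq (contractLeft_mem_span_image_of_mem_twist (hΘL φ hφ) hc), rfl⟩)
  · rw [gen_contract_secant (hED φ hφ) (hED ψ hψ)
      (contractLeft_contractLeft_eq_zero_of_mem_twist (hΘL φ hφ) (hΘL ψ hψ) hc)]
    exact Submodule.mem_sup_right (Submodule.smul_mem _ _ ⟨_, mul_mem_wedgeBlock
      (contractLeft_mem_span_image_of_mem_twist (hΘL ψ hψ) hc)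
      (contractLeft_mem_span_image_of_mem_twist (hΘL φ hφ) hc), rfl⟩)

/-- **`E·W ≤ span L Θ (a·1 + b·E)`** when `b` is a unit and `c` is NON-DEGENERATE (`ι_φ c`, `φ ∈ Θ`, spans `L`):
`E ∧ q ∧ ι_φ c = b⁻¹·(q ∧ ι_φ x)` is a mixed generator. [cite: BourbakiAlgebre1a3, Ch. III §11 no. 9] -/
theorem map_wedgeBlock_le_span_secant (hEc : ∀ z, Commute E z)
    (hED : ∀ φ ∈ Θ, ∀ z : ExteriorAlgebra K V, contractLeft φ (E * z) = E * (contractLeft φ z + contractLeft φ c * z))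
    (hnd : ∀ q ∈ L, ι K q ∈ Submodule.span K {y : ExteriorAlgebra K V | ∃ φ ∈ Θ, y = contractLeft φ c})
    (a : K) {b : K} (hb : IsUnit b) :
    (wedgeBlock L).map (LinearMap.mulLeft K E) ≤ span L Θ (algebraMap K _ a + b • E) := by
  obtain ⟨ub, rfl⟩ := hb
  rw [Submodule.map_le_iff_le_comap]
  refine Submodule.span_le.mpr ?_
  rintro y ⟨q₁, hq₁, q₂, hq₂, rfl⟩
  rw [SetLike.mem_coe, Submodule.mem_comap, LinearMap.mulLeft_apply]
  have key : ∀ β ∈ Submodule.span K {y : ExteriorAlgebra K V | ∃ φ ∈ Θ, y = contractLeft φ c},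
      E * (ι K q₁ * β) ∈ span L Θ (algebraMap K _ a + (ub : K) • E) := by
    intro β hβ
    induction hβ using Submodule.span_induction with
    | mem y hy =>
      obtain ⟨φ, hφ, rfl⟩ := hy
      have h : ι K q₁ * contractLeft φ (algebraMap K _ a + (ub : K) • E) ∈ span L Θ (algebraMap K _ a + (ub : K) • E) :=
        Submodule.subset_span (Or.inl (Or.inr ⟨q₁, hq₁, φ, hφ, rfl⟩))
      rw [gen_mixed_secant hEc (hED φ hφ)] at h
      have h' := Submodule.smul_mem _ (↑ub⁻¹ : K) h
      rwa [smul_smul, Units.inv_mul, one_smul] at h'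
    | zero => rw [mul_zero, mul_zero]; exact Submodule.zero_mem _
    | add y z _ _ hy hz => rw [mul_add, mul_add]; exact Submodule.add_mem _ hy hz
    | smul r y _ hy => rw [mul_smul_comm, mul_smul_comm]; exact Submodule.smul_mem _ r hy
  exact key _ (hnd q₂ hq₂)

/-- **`W ≤ span L Θ (a·1 + b·E)`** under the same hypotheses plus `a` a unit: `a·q₁∧q₂ = q₁∧q₂∧x - b·E∧q₁∧q₂`.
[cite: BourbakiAlgebre1a3, Ch. III §7] -/
theorem wedgeBlock_le_span_secant (hEc : ∀ z, Commute E z)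
    (hED : ∀ φ ∈ Θ, ∀ z : ExteriorAlgebra K V, contractLeft φ (E * z) = E * (contractLeft φ z + contractLeft φ c * z))
    (hnd : ∀ q ∈ L, ι K q ∈ Submodule.span K {y : ExteriorAlgebra K V | ∃ φ ∈ Θ, y = contractLeft φ c})
    {a b : K} (ha : IsUnit a) (hb : IsUnit b) :
    wedgeBlock L ≤ span L Θ (algebraMap K _ a + b • E) := by
  refine Submodule.span_le.mpr ?_
  rintro y ⟨q₁, hq₁, q₂, hq₂, rfl⟩
  obtain ⟨ua, rfl⟩ := ha
  have h1 : ι K q₁ * (ι K q₂ * (algebraMap K _ (ua : K) + b • E)) ∈ span L Θ (algebraMap K _ (ua : K) + b • E) :=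
    Submodule.subset_span (Or.inl (Or.inl ⟨q₁, hq₁, q₂, hq₂, rfl⟩))
  have h2 : E * (ι K q₁ * ι K q₂) ∈ span L Θ (algebraMap K _ (ua : K) + b • E) :=
    map_wedgeBlock_le_span_secant hEc hED hnd _ hb ⟨_, Submodule.subset_span ⟨q₁, hq₁, q₂, hq₂, rfl⟩, rfl⟩
  rw [gen_wedge_secant hEc] at h1
  have h3 := Submodule.sub_mem _ h1 (Submodule.smul_mem _ b h2)
  rw [add_sub_cancel_right] at h3
  have h4 := Submodule.smul_mem _ (↑ua⁻¹ : K) h3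
  rwa [smul_smul, Units.inv_mul, one_smul] at h4

/-- **STRUCTURE THEOREM `span L Θ (a·1 + b·E) = W ⊔ E·W`** (`W = Λ²`-block of `L`): `Θ` kills `L`,
`c ∈ span{v ∧ q : q ∈ L}` non-degenerate on `Θ`, `E` central with the conjugation rule of `e^{c}`, `a, b` units.
[cite: BourbakiAlgebre1a3, Ch. III §11 no. 9] [cite: BuchweitzFlenner2008HH, Prop. 6.4.4] -/
theorem span_secant_eq (hΘL : ∀ θ ∈ Θ, ∀ q ∈ L, θ q = 0)
    (hc : c ∈ Submodule.span K {z : ExteriorAlgebra K V | ∃ v : V, ∃ q ∈ L, z = ι K v * ι K q})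
    (hEc : ∀ z, Commute E z)
    (hED : ∀ φ ∈ Θ, ∀ z : ExteriorAlgebra K V, contractLeft φ (E * z) = E * (contractLeft φ z + contractLeft φ c * z))
    (hnd : ∀ q ∈ L, ι K q ∈ Submodule.span K {y : ExteriorAlgebra K V | ∃ φ ∈ Θ, y = contractLeft φ c})
    {a b : K} (ha : IsUnit a) (hb : IsUnit b) :
    span L Θ (algebraMap K _ a + b • E) = wedgeBlock L ⊔ (wedgeBlock L).map (LinearMap.mulLeft K E) :=
  le_antisymm (span_secant_le hΘL hc hEc hED a b)
    (sup_le (wedgeBlock_le_span_secant hEc hED hnd ha hb) (map_wedgeBlock_le_span_secant hEc hED hnd a hb))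

end Secant

/-! ### 3. Rank bookkeeping: `W ⊔ E·W = W ⊔ (E - 1)·W`, degrees, disjointness -/

/-- `W ⊔ E·W = W ⊔ (E - 1)·W` for any block `W` and any `E` (`E∧w = w + (E-1)∧w`). [folklore] -/
theorem sup_map_mulLeft_eq_sup_map_mulLeft_sub_one (W : Submodule K (ExteriorAlgebra K V)) (E : ExteriorAlgebra K V) :
    W ⊔ W.map (LinearMap.mulLeft K E) = W ⊔ W.map (LinearMap.mulLeft K (E - 1)) := by
  apply le_antisymm
  · refine sup_le le_sup_left (Submodule.map_le_iff_le_comap.mpr fun w hw => ?_)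
    rw [Submodule.mem_comap, LinearMap.mulLeft_apply,
      show E * w = w + (E - 1) * w by rw [sub_mul, one_mul, add_sub_cancel]]
    exact Submodule.add_mem _ (Submodule.mem_sup_left hw) (Submodule.mem_sup_right ⟨w, hw, rfl⟩)
  · refine sup_le le_sup_left (Submodule.map_le_iff_le_comap.mpr fun w hw => ?_)
    rw [Submodule.mem_comap, LinearMap.mulLeft_apply, sub_mul, one_mul]
    exact Submodule.sub_mem _ (Submodule.mem_sup_right ⟨w, hw, rfl⟩) (Submodule.mem_sup_left hw)

/-- `(Σ_{k<M} r_k c^{k+1}) ∧ w` lies in the degrees `≠ d` for `c ∈ Λ²`, `w ∈ Λᵈ` (each term has degree `d + 2k + 2`).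
[cite: BourbakiAlgebre1a3, Ch. III §7 no. 1] -/
theorem sum_smul_pow_succ_mul_mem_iSup_ne {c : ExteriorAlgebra K V} (hc2 : c ∈ ⋀[K]^2 V) {d : ℕ}
    {w : ExteriorAlgebra K V} (hw : w ∈ ⋀[K]^d V) (M : ℕ) (r : ℕ → K) :
    (∑ k ∈ Finset.range M, r k • c ^ (k + 1)) * w ∈ ⨆ (i : ℕ) (_ : i ≠ d), ⋀[K]^i V := by
  rw [Finset.sum_mul]
  refine Submodule.sum_mem _ fun k _ => ?_
  rw [smul_mul_assoc]
  refine Submodule.smul_mem _ _ ?_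
  have h := ExteriorLefschetz.pow_mul_mem_exteriorPower hc2 (k + 1) hw
  exact Submodule.mem_iSup_of_mem (2 * (k + 1) + d) (Submodule.mem_iSup_of_mem (by omega) h)

/-- `Λᵈ V` is disjoint from the sum of the other graded pieces (the grading is an internal direct sum).
[cite: BourbakiAlgebre1a3, Ch. III §7 no. 1] -/
theorem disjoint_exteriorPower_iSup_ne (d : ℕ) : Disjoint (⋀[K]^d V) (⨆ (i : ℕ) (_ : i ≠ d), ⋀[K]^i V) :=
  iSupIndep_def.mp (DirectSum.Decomposition.isInternal (fun n : ℕ => ⋀[K]^n V)).submodule_iSupIndep d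

end Ring

/-! ### 4. Over a field of characteristic `0`: `E = e^{c}`, and `finrank (W ⊔ e^{c}W) = finrank W + finrank (c ∧ W)` -/

section Field
variable {K : Type*} [Field K] [CharZero K] {V : Type*} [AddCommGroup V] [Module K V]

omit [CharZero K] in
/-- Padding: if `c^N = 0` the exponential sums `Σ_{k<M} cᵏ/k!` agree for all `M ≥ N`. [folklore] -/
theorem expSum_eq_of_pow_eq_zero {c : ExteriorAlgebra K V} {N : ℕ} (hN : c ^ N = 0) {M : ℕ} (hNM : N ≤ M) :
    (∑ k ∈ Finset.range M, ((k.factorial : K)⁻¹) • c ^ k) = ∑ k ∈ Finset.range N, ((k.factorial : K)⁻¹) • c ^ k := by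
  obtain ⟨t, rfl⟩ := Nat.exists_eq_add_of_le hNM
  rw [Finset.sum_range_add, add_eq_left]
  exact Finset.sum_eq_zero fun k _ => by rw [pow_add, hN, zero_mul, smul_zero]

omit [CharZero K] in
/-- `e^{c} - 1 = c ∧ E'` with `E' = Σ_{k<M+1} cᵏ/(k+1)!` (for the padded sum `e^{c} = Σ_{k<M+2} cᵏ/k!`), and the same
difference as the sum `Σ_{k<M+1} c^{k+1}/(k+1)!`. [folklore] -/
theorem expSum_sub_one_eq (c : ExteriorAlgebra K V) (M : ℕ) :
    (∑ k ∈ Finset.range (M + 2), ((k.factorial : K)⁻¹) • c ^ k) - 1 =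
      ∑ k ∈ Finset.range (M + 1), (((k + 1).factorial : K)⁻¹) • c ^ (k + 1) := by
  rw [Finset.sum_range_succ' _ (M + 1), pow_zero, Nat.factorial_zero, Nat.cast_one, inv_one, one_smul, add_sub_cancel_right]

omit [CharZero K] in
/-- The factorisation `Σ_{k<M+1} c^{k+1}/(k+1)! = E' ∧ c`, `E' = Σ_{k<M+1} cᵏ/(k+1)!`. [folklore] -/
theorem sum_pow_succ_eq_mul (c : ExteriorAlgebra K V) (M : ℕ) :
    (∑ k ∈ Finset.range (M + 1), (((k + 1).factorial : K)⁻¹) • c ^ (k + 1)) =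
      (∑ k ∈ Finset.range (M + 1), (((k + 1).factorial : K)⁻¹) • c ^ k) * c := by
  rw [Finset.sum_mul]
  exact Finset.sum_congr rfl fun k _ => by rw [smul_mul_assoc, pow_succ]

omit [CharZero K] in
/-- `E' = Σ_{k<M+1} cᵏ/(k+1)!` is a UNIT for `c ∈ span{v ∧ w}` nilpotent: `1 +` a commuting sum of nilpotents.
[cite: BourbakiAlgebre1a3, Ch. III §7] -/
theorem isUnit_expSum' {c : ExteriorAlgebra K V}
    (hc : c ∈ Submodule.span K {z : ExteriorAlgebra K V | ∃ v w : V, z = ι K v * ι K w}) (M : ℕ) :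
    IsUnit (∑ k ∈ Finset.range (M + 1), (((k + 1).factorial : K)⁻¹) • c ^ k) := by
  rw [Finset.sum_range_succ', pow_zero, zero_add, Nat.factorial_one, Nat.cast_one, inv_one, one_smul]
  refine IsNilpotent.isUnit_add_one (Commute.isNilpotent_sum (fun k _ => ?_) fun i j _ _ => ?_)
  · exact ((isNilpotent_of_mem_span_ι_mul_ι hc).pow_succ k).smul _
  · exact (((Commute.refl c).pow_pow (i + 1) (j + 1)).smul_left _).smul_right _

omit [CharZero K] in
/-- `E'` (indeed any `K`-combination of powers of `c ∈ span{v ∧ w}`) is central. [cite: BourbakiAlgebre1a3, Ch. III §7] -/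
theorem commute_sum_smul_pow {c : ExteriorAlgebra K V}
    (hc : c ∈ Submodule.span K {z : ExteriorAlgebra K V | ∃ v w : V, z = ι K v * ι K w}) (M : ℕ) (r : ℕ → K)
    (z : ExteriorAlgebra K V) : Commute (∑ k ∈ Finset.range M, r k • c ^ k) z :=
  Commute.sum_left _ _ _ fun k _ => ((commute_of_mem_span_ι_mul_ι hc z).pow_left k).smul_left _

omit [CharZero K] in
/-- **`finrank (W ⊔ e^{c}·W) = finrank W + finrank (c ∧ W)`** for a block `W ⊆ Λᵈ V` and a nilpotent `c ∈ span{v ∧ w}`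
(`c^N = 0`, `e^{c} = Σ_{k<N} cᵏ/k!`): `W ⊔ e^{c}W = W ⊔ (e^{c} - 1)W` (`sup_map_mulLeft_eq_sup_map_mulLeft_sub_one`), the
second summand sits in degrees `≠ d` hence meets `W` trivially, and `(e^{c} - 1)W = E' ∧ (c ∧ W)` with `E'` a central
unit has the dimension of `c ∧ W`. [cite: BourbakiAlgebre1a3, Ch. III §7] -/
theorem finrank_sup_map_expSum_eq {d : ℕ} {W : Submodule K (ExteriorAlgebra K V)} (hW : W ≤ ⋀[K]^d V)
    [FiniteDimensional K W] {c : ExteriorAlgebra K V}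
    (hc : c ∈ Submodule.span K {z : ExteriorAlgebra K V | ∃ v w : V, z = ι K v * ι K w}) {N : ℕ} (hN : c ^ N = 0) :
    finrank K ↥(W ⊔ W.map (LinearMap.mulLeft K (∑ k ∈ Finset.range N, ((k.factorial : K)⁻¹) • c ^ k))) =
      finrank K W + finrank K ↥(W.map (LinearMap.mulLeft K c)) := by
  -- pad the exponential sum to `N + 2` terms and factor `e^{c} - 1 = E' ∧ c`
  set E' : ExteriorAlgebra K V := ∑ k ∈ Finset.range (N + 1), (((k + 1).factorial : K)⁻¹) • c ^ k with hE'
  have hsub : (∑ k ∈ Finset.range N, ((k.factorial : K)⁻¹) • c ^ k) - 1 = E' * c := by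
    rw [← expSum_eq_of_pow_eq_zero hN (by omega : N ≤ N + 2), expSum_sub_one_eq, sum_pow_succ_eq_mul]
  have hunit : IsUnit E' := isUnit_expSum' hc N
  rw [sup_map_mulLeft_eq_sup_map_mulLeft_sub_one, hsub, LinearMap.mulLeft_mul, Submodule.map_comp]
  -- `E' ∧ (c ∧ W)` has the dimension of `c ∧ W`
  have hiso : finrank K ↥((W.map (LinearMap.mulLeft K c)).map (LinearMap.mulLeft K E')) =
      finrank K ↥(W.map (LinearMap.mulLeft K c)) :=
    (Submodule.equivMapOfInjective (LinearMap.mulLeft K E') hunit.mul_right_injective _).finrank_eq.symm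
  -- the second summand lies in degrees `≠ d`, `W` in degree `d`: they are disjoint
  have hle : (W.map (LinearMap.mulLeft K c)).map (LinearMap.mulLeft K E') ≤ ⨆ (i : ℕ) (_ : i ≠ d), ⋀[K]^i V := by
    rw [← Submodule.map_comp, ← LinearMap.mulLeft_mul, ← sum_pow_succ_eq_mul, Submodule.map_le_iff_le_comap]
    intro w hw
    rw [Submodule.mem_comap, LinearMap.mulLeft_apply]
    exact sum_smul_pow_succ_mul_mem_iSup_ne (mem_exteriorPower_two_of_mem_span_ι_mul_ι hc) (hW hw) (N + 1) _
  have hdisj : W ⊓ (W.map (LinearMap.mulLeft K c)).map (LinearMap.mulLeft K E') = ⊥ :=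
    disjoint_iff.mp ((disjoint_exteriorPower_iSup_ne (K := K) (V := V) d).mono hW hle)
  have hsum := Submodule.finrank_sup_add_finrank_inf_eq W ((W.map (LinearMap.mulLeft K c)).map (LinearMap.mulLeft K E'))
  rw [hdisj, finrank_bot, add_zero, hiso] at hsum
  exact hsum

/-- **THE THETA-SECANT RANK FORMULA (all dimensions)**: for `Θ` killing `L`, a twist class
`c ∈ span{v ∧ q : q ∈ L}` with `c^N = 0`, NON-DEGENERATE on `Θ` (`ι_φ c`, `φ ∈ Θ`, spans `L`), and `a, b ≠ 0`,
`finrank span L Θ (a·1 + b·e^{c}) = finrank W + finrank (c ∧ W)`, `W` the `Λ²`-block of `L`, `e^{c} = Σ_{k<N} cᵏ/k!` —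
«`r₂ = dim Λ²L + rank(Lefschetz c ∧ · on Λ²L)`», the two K-isotypic pieces of th-7's factor theorem A.3 for the
theta-divisor 2-secant factor. [cite: BuchweitzFlenner2008HH, Prop. 6.4.4]
[cite: Lange2023AbelianVarietiesComplex, §7.3.2 (the Lefschetz operator)] -/
theorem finrank_span_secant_eq_add {L : Set V} {Θ : Set (Module.Dual K V)} (hΘL : ∀ θ ∈ Θ, ∀ q ∈ L, θ q = 0)
    {c : ExteriorAlgebra K V}
    (hc : c ∈ Submodule.span K {z : ExteriorAlgebra K V | ∃ v : V, ∃ q ∈ L, z = ι K v * ι K q}) {N : ℕ}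
    (hN : c ^ N = 0)
    (hnd : ∀ q ∈ L, ι K q ∈ Submodule.span K {y : ExteriorAlgebra K V | ∃ φ ∈ Θ, y = contractLeft φ c})
    {a b : K} (ha : a ≠ 0) (hb : b ≠ 0) [FiniteDimensional K (wedgeBlock (K := K) L)] :
    finrank K (span L Θ (algebraMap K _ a + b • ∑ k ∈ Finset.range N, ((k.factorial : K)⁻¹) • c ^ k)) =
      finrank K (wedgeBlock (K := K) L) + finrank K ↥((wedgeBlock (K := K) L).map (LinearMap.mulLeft K c)) := by
  have hc' := span_twist_le L hc
  rw [span_secant_eq hΘL hc (commute_expSum hc' N)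
    (fun φ _ z => contractLeft_expSum_mul φ hc' hN z) hnd (Ne.isUnit ha) (Ne.isUnit hb)]
  exact finrank_sup_map_expSum_eq (wedgeBlock_le L) hc' hN

end Field

end ContractionSpan

end Summit.Ventures.HSemireg

end
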